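import Summits.QuantumFields.YangMills.Theorems.FluctuationComparisonRegPrIntLS2BetaSmallBondGaugeFluxDatumVortexCell
import HarnessLib

/-!
# S2β · D-GUARD, UPPER SIDE — (W2) THE `SU(2)` VORTEX-LATTICE GAUGE ON THE FLUX DATUM, FILE 2∕3: THE CELL GAUGE ON `(ℤ∕N)²` — one `e₀`-step and one `e₁`-step of
# `Q(X,Y) = H(πp∕(ℓ−1), πq∕(ℓ−1))·E(Λ(X,Y))`, `p = X mod ℓ`, `q = Y mod ℓ`, `Λ(X,Y) = −πp∕(ℓ−1) + 2πpq∕(ℓ(ℓ−1)) + 2π·(X div ℓ)·Y∕ℓ`, `N = kℓ²`, each within `2π∕(ℓ−1)`,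
# INCLUDING the cell boundaries and the torus wraps `X, Y = N − 1 → 0`

Cell `ym3-torus` (YM ladder rung R3 = continuum `SU(2)` Yang–Mills on the three-torus at fixed lattice data — a RUNG: NOT d = 4, NOT infinite volume,
NOT a mass gap, NOT Clay).  Width seat «width 8» `ym3-torus-px8` (gen 28, toron∕flux lineage ✓p826411 → px17 (W1) ✓p837971), FREE px helper on crux
`stmt-QuantumFields-20520`; `--kind proof --supports stmt-QuantumFields-20520 --as helper`, count-neutral, DEFINITION-FREE (0 `def`, 0 `instance`, 0 `notation`,
0 `sorry`, default heartbeats).  NAMED (W2) by the architect lineage (px17 g23, STATUS 2026-09-01T00:07:19Z «GO, WITH PRIORITY»).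

WHAT IS PROVED HERE (sorry-free; the maps `E`, `H`, `Λ`, `Q` DISPLAYED BY THEIR DEFINING HYPOTHESES — no `def`; FILE 1∕3 ✓`…FluxDatumVortexCell` supplies the `S³` kinematics,
FILE 3∕3 `…FluxDatumVortexGauge` the motivation and the lattice theorem (W2)).
* `succ_mod_div_of_lt`, `succ_eq_mul_of_mod_succ_eq`, `succ_mod_eq_succ_of_not_dvd` (successor arithmetic on `ℤ∕N` with `ℓ ∣ N`); `norm_cellGauge` (`|Q| = 1`).
* ★★ `norm_cellGauge_step_dir0` — `|Q(X,Y) − Q(X+1 mod N, Y)| ≤ 2π∕(ℓ−1)`: inside a cell one meridian step `π∕(ℓ−1)` + the abelian phase `π(1 − 2q∕ℓ)∕(ℓ−1)`; across a cell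
  boundary the poles `−1 → 1` absorb a phase jump `≡ π (mod 2π)` EXACTLY — multiple `−(Y div ℓ)` without wrap, `(X div ℓ)(Y div ℓ) + q·k` at the wrap (uses `ℓ² ∣ N`).
* ★★ `norm_cellGauge_step_dir1` — `|Q(X,Y)·E(X·2π∕ℓ²) − Q(X, Y+1 mod N)| ≤ 2π∕(ℓ−1)` (the datum's direction, bond phase `X·φ`, `φ = 2π∕ℓ²`): inside a cell one parallel
  step `π∕(ℓ−1)` + the residual `2πp∕(ℓ²(ℓ−1)) ≤ π∕(ℓ−1)`; across a cell boundary the meridians `E(−σ) → E(σ)` absorb `2σ` and leave the same residual — multiple `0`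
  without wrap, `(X div ℓ)·k·ℓ` at the wrap.
WHY THE PHASES CLOSE (magnetic-translation bookkeeping, checked by `field_simp`∕`ring`∕`linear_combination` over `X = ℓ·(X div ℓ) + p`, `Y = ℓ·(Y div ℓ) + q`): the cell gauge is
the symmetric-type gauge of ONE cell translated by `ℓ·(X div ℓ)` with the compensating phase `2π(X div ℓ)Y∕ℓ`; flux `2π` per cell makes the horizontal transition `q`-affine
and the vertical one `p`-affine, and the hemisphere's boundary values (`1`, `−1`, `E σ`, `E(−σ)`) cancel them up to the `O(ℓ⁻²)` residual.

HONEST SCOPE.  Elementary quaternion∕lattice bookkeeping (explicit trigonometry on `S³ ⊂ ℍ`, `ZMod`∕`div`∕`mod` casework) over landed kinematics (pub-ymgap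
✓`K0UniformFluxConfig` via px17 ✓`…SmallBondGaugeCurvatureFloor`, lit ✓`SU2Haar` ∕ ✓`T4HaarSU2ExpChart` ∕ ✓`T4HaarSU2Translate`); a POSITIVE statement about ONE datum
family (the minimax bond size of the uniform-flux datum is `Θ(√θ)` uniformly in the volume, attained by an explicit `SU(2)` gauge: `dist1 ≤ 2π∕(ℓ−1) ≈ 2.5·√θ_min` is an
explicit-construction constant, against the relaxation numerics FL-39 `C ≈ 0.9–1.6` and the curvature floor `≈ 0.28·√θ`); it is NOT the conjectured supplier
`hsupp⁺ : arc ≤ C(√θ_J + c∕N_J)` for GENERAL data (which remains open), NOT `hsupp` (FALSE below the height floor by kernel ∕ OPEN above), and nothing of Bałaban's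
renormalisation-group analysis is asserted, proved or refuted ([Balaban1985RegularSpaces] Lemma 1 p.79 ∕ Thm 2 p.83 fix LOCAL small-bond gauges on cubes — consistent, not
used); GAP♯∘ (`stub_uniformFibreGapOrbit`), the five registered stubs (0∕5), S2β, crux 20520, 19936, 19200, `YM3TorusSU2` are NOT proved; no registered stub is closed;
rung R3 = `SU(2)` YM₃ on T³ at fixed lattice data — NOT d = 4, NOT infinite volume, NOT a mass gap, NOT Clay; the Yang–Mills mass gap is NOT proved.  Axioms standard.
References: T. Bałaban, CMP **99** (1985) 75–102 [Balaban1985RegularSpaces] (Lemma 1 p.79, (1.29) p.81, Thm 2 p.83); CMP **98** (1985) 17–51 [Balaban1985Averaging]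
((8)–(9) pp.18–19: gauge transformations of bond variables).
-/

set_option autoImplicit false

noncomputable section

namespace Summit.QuantumFields.YangMills.Theorems.FluctuationComparisonRegPrIntLS2BetaSmallBondGaugeFluxDatumVortexSteps

open scoped Real Quaternion
open Literature.MathematicalPhysics.QuantumFieldTheory.Balaban1983to89
open Summit.QuantumFields.YangMills.Theorems.FluctuationComparisonRegPrIntLS2BetaSmallBondGaugeFluxDatumVortexCell

/-! ## §4 The vortex cell on `ℕ²`: one `e₀`-step and one `e₁`-step of the gauge `Q(X,Y) = H(πp∕(ℓ−1), πq∕(ℓ−1))·E(Λ(X,Y))`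
(`p = X mod ℓ`, `q = Y mod ℓ`, `Λ(X,Y) = −πp∕(ℓ−1) + 2πpq∕(ℓ(ℓ−1)) + 2π·(X div ℓ)·Y∕ℓ`) on the discrete torus `(ℤ∕N)²`, `N = kℓ²` -/

/-- Elementary: below the last residue the successor stays in the same cell. [folklore] -/
theorem succ_mod_div_of_lt {ℓ X : ℕ} (h : X % ℓ + 1 < ℓ) : (X + 1) % ℓ = X % ℓ + 1 ∧ (X + 1) / ℓ = X / ℓ := by
  have hℓ : 0 < ℓ := by omega
  have key := (Nat.div_mod_unique (a := X + 1) (b := ℓ) (c := X % ℓ + 1) (d := X / ℓ) hℓ).2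
    ⟨by have := Nat.mod_add_div X ℓ; linarith, h⟩
  exact ⟨key.2, key.1⟩

/-- Elementary: at the last residue the successor starts the next cell. [folklore] -/
theorem succ_eq_mul_of_mod_succ_eq {ℓ X : ℕ} (h : X % ℓ + 1 = ℓ) : X + 1 = ℓ * (X / ℓ + 1) := by
  have := Nat.mod_add_div X ℓ
  rw [mul_add, mul_one]; omega

/-- Elementary: on the cycle `ℤ∕N` with `ℓ ∣ N`, a successor not divisible by `ℓ` does not wrap. [folklore] -/
theorem succ_mod_eq_succ_of_not_dvd {ℓ N X : ℕ} (hℓN : ℓ ∣ N) (hX : X < N) (h : ¬ ℓ ∣ X + 1) : (X + 1) % N = X + 1 := by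
  apply Nat.mod_eq_of_lt
  rcases Nat.lt_or_ge (X + 1) N with h1 | h1
  · exact h1
  · exfalso; exact h (by rw [show X + 1 = N by omega]; exact hℓN)

section Steps

variable (E : ℝ → ℍ) (hE : ∀ t, E t = ⟨Real.cos t, Real.sin t, 0, 0⟩)
variable (H : ℝ → ℝ → ℍ) (hH : ∀ σ τ, H σ τ = ⟨Real.cos σ, Real.sin σ * Real.cos τ, Real.sin σ * Real.sin τ, 0⟩)
variable {ℓ k N : ℕ} (hℓ : 2 ≤ ℓ) (hN : k * ℓ ^ 2 = N)
variable (Λ : ℕ → ℕ → ℝ)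
  (hΛ : ∀ X Y, Λ X Y = -(π * (X % ℓ : ℕ) / ((ℓ : ℝ) - 1)) + 2 * π * (X % ℓ : ℕ) * (Y % ℓ : ℕ) / ((ℓ : ℝ) * ((ℓ : ℝ) - 1))
    + 2 * π * (X / ℓ : ℕ) * Y / (ℓ : ℝ))
variable (Q : ℕ → ℕ → ℍ)
  (hQ : ∀ X Y, Q X Y = H (π * (X % ℓ : ℕ) / ((ℓ : ℝ) - 1)) (π * (Y % ℓ : ℕ) / ((ℓ : ℝ) - 1)) * E (Λ X Y))
include hE hH hℓ hN hΛ hQ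

omit hℓ hN hΛ in
/-- The gauge quaternion is a unit. [folklore] -/
theorem norm_cellGauge (X Y : ℕ) : ‖Q X Y‖ = 1 := by
  rw [hQ, norm_mul, norm_hemi H hH, norm_phase E hE, one_mul]

/-- ★★ **THE `e₀`-STEP OF THE VORTEX CELL**: `|Q(X,Y) − Q(X+1 mod N, Y)| ≤ 2π∕(ℓ−1)` — inside a cell one meridian step `π∕(ℓ−1)` plus the
abelian phase `π(1 − 2q∕ℓ)∕(ℓ−1)`; across a cell boundary (poles `−1 → 1`) the phase jump is `π` modulo `2π` EXACTLY, including the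
torus wrap `X = N − 1 → 0` (there the multiple is `(X div ℓ)·(Y div ℓ) + q·k`, using `ℓ² ∣ N`). [folklore] -/
theorem norm_cellGauge_step_dir0 (X Y : ℕ) (hX : X < N) : ‖Q X Y - Q ((X + 1) % N) Y‖ ≤ 2 * π / ((ℓ : ℝ) - 1) := by
  have hℓr : (1 : ℝ) < ℓ := by exact_mod_cast (show 1 < ℓ by omega)
  have hℓ0 : (ℓ : ℝ) ≠ 0 := by positivity
  have hℓ1 : (ℓ : ℝ) - 1 ≠ 0 := by linarith
  have hℓ1p : 0 < (ℓ : ℝ) - 1 := by linarith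
  have hℓpos : 0 < ℓ := by omega
  have hℓN : ℓ ∣ N := ⟨k * ℓ, by rw [← hN]; ring⟩
  set p := X % ℓ with hp
  set a := X / ℓ with ha
  set q := Y % ℓ with hq
  set b := Y / ℓ with hb
  have hpℓ : p < ℓ := Nat.mod_lt _ hℓpos
  have hqℓ : q < ℓ := Nat.mod_lt _ hℓpos
  have hYr : (Y : ℝ) = ℓ * b + q := by rw [hb, hq]; exact_mod_cast (Nat.div_add_mod Y ℓ).symm
  have hXr : (X : ℝ) = ℓ * a + p := by rw [ha, hp]; exact_mod_cast (Nat.div_add_mod X ℓ).symm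
  rcases Nat.lt_or_ge (p + 1) ℓ with hin | hcross
  · -- interior step: same cell, one meridian step
    obtain ⟨hmod, hdiv⟩ := succ_mod_div_of_lt (ℓ := ℓ) (X := X) hin
    have hnd : ¬ ℓ ∣ X + 1 := by
      intro hdvd
      have h0 := Nat.mod_eq_zero_of_dvd hdvd
      omega
    rw [succ_mod_eq_succ_of_not_dvd hℓN hX hnd, hQ, hQ, hmod]
    have hΛd : Λ X Y - Λ (X + 1) Y = π / ((ℓ : ℝ) - 1) * (1 - 2 * (q : ℝ) / ℓ) := by
      rw [hΛ, hΛ, hmod, hdiv]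
      push_cast
      field_simp
      ring
    have hq0 : (0 : ℝ) ≤ q := Nat.cast_nonneg _
    have hq1 : (q : ℝ) ≤ ℓ := by exact_mod_cast hqℓ.le
    have habs : |Λ X Y - Λ (X + 1) Y| ≤ π / ((ℓ : ℝ) - 1) := by
      rw [hΛd, abs_mul, abs_of_pos (by positivity : (0 : ℝ) < π / ((ℓ : ℝ) - 1))]
      have h1 : |1 - 2 * (q : ℝ) / ℓ| ≤ 1 := by
        rw [abs_le]
        constructor
        · have : 2 * (q : ℝ) / ℓ ≤ 2 := by rw [div_le_iff₀ (by positivity)]; linarith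
          linarith
        · have : 0 ≤ 2 * (q : ℝ) / ℓ := by positivity
          linarith
      calc π / ((ℓ : ℝ) - 1) * |1 - 2 * (q : ℝ) / ℓ| ≤ π / ((ℓ : ℝ) - 1) * 1 := by gcongr
        _ = π / ((ℓ : ℝ) - 1) := mul_one _
    have hrow : ‖H (π * (p : ℕ) / ((ℓ : ℝ) - 1)) (π * (q : ℕ) / ((ℓ : ℝ) - 1))
        - H (π * ((p + 1 : ℕ) : ℝ) / ((ℓ : ℝ) - 1)) (π * (q : ℕ) / ((ℓ : ℝ) - 1))‖ ≤ π / ((ℓ : ℝ) - 1) := by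
      refine (norm_hemi_sub_hemi_row_le H hH _ _ _).trans (le_of_eq ?_)
      push_cast
      rw [show π * (p : ℝ) / ((ℓ : ℝ) - 1) - π * ((p : ℝ) + 1) / ((ℓ : ℝ) - 1) = -(π / ((ℓ : ℝ) - 1)) by
        field_simp; ring, abs_neg, abs_of_pos (by positivity)]
    calc _ ≤ |Λ X Y - Λ (X + 1) Y| + _ := norm_mul_phase_sub_mul_phase_le E hE (norm_hemi H hH _ _) _ _ _
      _ ≤ π / ((ℓ : ℝ) - 1) + π / ((ℓ : ℝ) - 1) := add_le_add habs hrow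
      _ = 2 * π / ((ℓ : ℝ) - 1) := by ring
  · -- boundary step: poles, the phase jump is `π` modulo `2π`
    have hpe : p + 1 = ℓ := by omega
    have hpr : (p : ℝ) = ℓ - 1 := by
      have : ((p + 1 : ℕ) : ℝ) = ℓ := by exact_mod_cast hpe
      push_cast at this; linarith
    have hXs : X + 1 = ℓ * (a + 1) := succ_eq_mul_of_mod_succ_eq hpe
    have hdvd : ℓ ∣ X + 1 := ⟨a + 1, hXs⟩
    have hX'mod : (X + 1) % N % ℓ = 0 := Nat.mod_eq_zero_of_dvd ((Nat.dvd_mod_iff hℓN).2 hdvd)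
    have hσ : π * (p : ℝ) / ((ℓ : ℝ) - 1) = π := by rw [hpr]; field_simp
    have hσ' : π * (((X + 1) % N % ℓ : ℕ) : ℝ) / ((ℓ : ℝ) - 1) = 0 := by rw [hX'mod]; simp
    rw [hQ, hQ, hσ, hσ']
    have hΛX : Λ X Y = -π + 2 * π * q / ℓ + 2 * π * a * b + 2 * π * a * q / ℓ := by
      rw [hΛ, ← hp, ← ha, ← hq, hpr, hYr]; field_simp; ring
    -- the two sub-cases of the cycle `ℤ∕N`: no wrap ∕ wrap
    rcases Nat.lt_or_ge (X + 1) N with hlt | hge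
    · have hX' : (X + 1) % N = X + 1 := Nat.mod_eq_of_lt hlt
      have hmod' : (X + 1) % ℓ = 0 := Nat.mod_eq_zero_of_dvd hdvd
      have hdiv' : (X + 1) / ℓ = a + 1 := by rw [hXs, Nat.mul_div_cancel_left _ hℓpos]
      have hΛX' : Λ ((X + 1) % N) Y = 2 * π * (a + 1) * b + 2 * π * (a + 1) * q / ℓ := by
        rw [hX', hΛ, hmod', hdiv', hYr]; push_cast; field_simp; ring
      have hm : Λ X Y - Λ ((X + 1) % N) Y + π = ((-(b : ℤ) : ℤ) : ℝ) * (2 * π) := by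
        rw [hΛX, hΛX']; push_cast; ring
      rw [norm_cross_dir0_eq_zero E hE H hH _ _ _ _ _ hm]
      positivity
    · have hXN : X + 1 = N := by omega
      have hX' : (X + 1) % N = 0 := by rw [hXN, Nat.mod_self]
      have hΛX' : Λ ((X + 1) % N) Y = 0 := by
        rw [hX', hΛ, Nat.zero_mod, Nat.zero_div]; simp
      -- `ℓ(a+1) = N = kℓ²` ⇒ `(a + 1)∕ℓ = k`
      have hak : ((a : ℝ) + 1) / ℓ = k := by
        have h1 : ℓ * (a + 1) = ℓ * (k * ℓ) := by rw [← hXs, hXN, ← hN]; ring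
        have h2 := Nat.eq_of_mul_eq_mul_left hℓpos h1
        have h3 : (a : ℝ) + 1 = k * ℓ := by exact_mod_cast h2
        rw [h3]; field_simp
      have hm : Λ X Y - Λ ((X + 1) % N) Y + π = (((a : ℤ) * b + q * k : ℤ) : ℝ) * (2 * π) := by
        rw [hΛX, hΛX']; push_cast
        linear_combination (2 * π * (q : ℝ)) * hak
      rw [norm_cross_dir0_eq_zero E hE H hH _ _ _ _ _ hm]
      positivity

/-- ★★ **THE `e₁`-STEP OF THE VORTEX CELL** (the datum's direction, bond phase `X·φ`, `φ = 2π∕ℓ²`): `|Q(X,Y)·E(Xφ) − Q(X, Y+1 mod N)| ≤ 2π∕(ℓ−1)` —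
inside a cell one parallel step `π∕(ℓ−1)` plus the residual phase `2πp∕(ℓ²(ℓ−1)) ≤ 2π∕ℓ²`; across a cell boundary (meridians `E(−σ) → E(σ)`)
the phase jump is `2σ − 2πp∕(ℓ²(ℓ−1))` modulo `2π`, including the torus wrap `Y = N − 1 → 0` (multiple `(X div ℓ)·k·ℓ`). [folklore] -/
theorem norm_cellGauge_step_dir1 (X Y : ℕ) (hY : Y < N) :
    ‖Q X Y * E ((X : ℝ) * (2 * π / (ℓ : ℝ) ^ 2)) - Q X ((Y + 1) % N)‖ ≤ 2 * π / ((ℓ : ℝ) - 1) := by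
  have hℓr : (1 : ℝ) < ℓ := by exact_mod_cast (show 1 < ℓ by omega)
  have hℓ0 : (ℓ : ℝ) ≠ 0 := by positivity
  have hℓ1 : (ℓ : ℝ) - 1 ≠ 0 := by linarith
  have hℓ1p : 0 < (ℓ : ℝ) - 1 := by linarith
  have hℓpos : 0 < ℓ := by omega
  have hℓN : ℓ ∣ N := ⟨k * ℓ, by rw [← hN]; ring⟩
  set p := X % ℓ with hp
  set a := X / ℓ with ha
  set q := Y % ℓ with hq
  set b := Y / ℓ with hb
  have hpℓ : p < ℓ := Nat.mod_lt _ hℓpos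
  have hqℓ : q < ℓ := Nat.mod_lt _ hℓpos
  have hYr : (Y : ℝ) = ℓ * b + q := by rw [hb, hq]; exact_mod_cast (Nat.div_add_mod Y ℓ).symm
  have hXr : (X : ℝ) = ℓ * a + p := by rw [ha, hp]; exact_mod_cast (Nat.div_add_mod X ℓ).symm
  have hp0 : (0 : ℝ) ≤ p := Nat.cast_nonneg _
  have hp1 : (p : ℝ) ≤ ℓ - 1 := by
    have : ((p : ℕ) : ℝ) + 1 ≤ ℓ := by exact_mod_cast hpℓ
    linarith
  -- the residual phase `2πp∕(ℓ²(ℓ−1)) ≤ π∕(ℓ−1)`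
  have hres : |-(2 * π * (p : ℝ) / ((ℓ : ℝ) ^ 2 * ((ℓ : ℝ) - 1)))| ≤ π / ((ℓ : ℝ) - 1) := by
    rw [abs_neg, abs_of_nonneg (by positivity)]
    rw [div_le_div_iff₀ (by positivity) (by positivity)]
    have h2 : 2 * (p : ℝ) ≤ (ℓ : ℝ) ^ 2 := by nlinarith
    calc 2 * π * (p : ℝ) * ((ℓ : ℝ) - 1) = π * ((ℓ : ℝ) - 1) * (2 * p) := by ring
      _ ≤ π * ((ℓ : ℝ) - 1) * (ℓ : ℝ) ^ 2 := by gcongr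
      _ = π * ((ℓ : ℝ) ^ 2 * ((ℓ : ℝ) - 1)) := by ring
  rcases Nat.lt_or_ge (q + 1) ℓ with hin | hcross
  · -- interior step: same cell, one parallel step
    obtain ⟨hmod, hdiv⟩ := succ_mod_div_of_lt (ℓ := ℓ) (X := Y) hin
    have hnd : ¬ ℓ ∣ Y + 1 := by
      intro hdvd
      have h0 := Nat.mod_eq_zero_of_dvd hdvd
      omega
    rw [succ_mod_eq_succ_of_not_dvd hℓN hY hnd, hQ, hQ, hmod, mul_assoc, phase_mul_phase E hE]
    have hΛd : Λ X Y + (X : ℝ) * (2 * π / (ℓ : ℝ) ^ 2) - Λ X (Y + 1) = -(2 * π * (p : ℝ) / ((ℓ : ℝ) ^ 2 * ((ℓ : ℝ) - 1))) := by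
      rw [hΛ, hΛ, hmod, ← hp, ← ha, ← hq, hXr]
      push_cast
      field_simp
      ring
    have hcol : ‖H (π * (p : ℕ) / ((ℓ : ℝ) - 1)) (π * (q : ℕ) / ((ℓ : ℝ) - 1))
        - H (π * (p : ℕ) / ((ℓ : ℝ) - 1)) (π * ((q + 1 : ℕ) : ℝ) / ((ℓ : ℝ) - 1))‖ ≤ π / ((ℓ : ℝ) - 1) := by
      refine (norm_hemi_sub_hemi_col_le H hH _ _ _).trans (le_of_eq ?_)
      push_cast
      rw [show π * (q : ℝ) / ((ℓ : ℝ) - 1) - π * ((q : ℝ) + 1) / ((ℓ : ℝ) - 1) = -(π / ((ℓ : ℝ) - 1)) by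
        field_simp; ring, abs_neg, abs_of_pos (by positivity)]
    calc _ ≤ |Λ X Y + (X : ℝ) * (2 * π / (ℓ : ℝ) ^ 2) - Λ X (Y + 1)| + _ :=
          norm_mul_phase_sub_mul_phase_le E hE (norm_hemi H hH _ _) _ _ _
      _ ≤ π / ((ℓ : ℝ) - 1) + π / ((ℓ : ℝ) - 1) := add_le_add (by rw [hΛd]; exact hres) hcol
      _ = 2 * π / ((ℓ : ℝ) - 1) := by ring
  · -- boundary step: the two boundary meridians, the phase jump is `2σ − residual` modulo `2π`
    have hqe : q + 1 = ℓ := by omega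
    have hqr : (q : ℝ) = ℓ - 1 := by
      have : ((q + 1 : ℕ) : ℝ) = ℓ := by exact_mod_cast hqe
      push_cast at this; linarith
    have hYs : Y + 1 = ℓ * (b + 1) := succ_eq_mul_of_mod_succ_eq hqe
    have hdvd : ℓ ∣ Y + 1 := ⟨b + 1, hYs⟩
    have hY'mod : (Y + 1) % N % ℓ = 0 := Nat.mod_eq_zero_of_dvd ((Nat.dvd_mod_iff hℓN).2 hdvd)
    have hτ : π * (q : ℝ) / ((ℓ : ℝ) - 1) = π := by rw [hqr]; field_simp
    have hτ' : π * (((Y + 1) % N % ℓ : ℕ) : ℝ) / ((ℓ : ℝ) - 1) = 0 := by rw [hY'mod]; simp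
    rw [hQ, hQ, hτ, hτ', mul_assoc, phase_mul_phase E hE]
    have hΛX : Λ X Y + (X : ℝ) * (2 * π / (ℓ : ℝ) ^ 2)
        = -(π * p / ((ℓ : ℝ) - 1)) + 2 * π * p / ℓ + 2 * π * a * Y / ℓ + 2 * π * a / ℓ + 2 * π * p / (ℓ : ℝ) ^ 2 := by
      rw [hΛ, ← hp, ← ha, ← hq, hqr, hXr]; field_simp; ring
    -- the residual identity `2πp∕ℓ + 2πp∕ℓ² − 2πp∕(ℓ−1) = −2πp∕(ℓ²(ℓ−1))`
    have hkey : 2 * π * (p : ℝ) / ℓ + 2 * π * p / (ℓ : ℝ) ^ 2 - 2 * (π * p / ((ℓ : ℝ) - 1))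
        = -(2 * π * (p : ℝ) / ((ℓ : ℝ) ^ 2 * ((ℓ : ℝ) - 1))) := by
      field_simp; ring
    have hfin : |-(2 * π * (p : ℝ) / ((ℓ : ℝ) ^ 2 * ((ℓ : ℝ) - 1)))| ≤ 2 * π / ((ℓ : ℝ) - 1) :=
      hres.trans (by rw [div_le_div_iff₀ hℓ1p hℓ1p]; nlinarith [Real.pi_pos])
    rcases Nat.lt_or_ge (Y + 1) N with hlt | hge
    · have hY' : (Y + 1) % N = Y + 1 := Nat.mod_eq_of_lt hlt
      have hmod' : (Y + 1) % ℓ = 0 := Nat.mod_eq_zero_of_dvd hdvd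
      have hΛX' : Λ X ((Y + 1) % N) = -(π * p / ((ℓ : ℝ) - 1)) + 2 * π * a * ((Y : ℝ) + 1) / ℓ := by
        rw [hY', hΛ, hmod', ← hp, ← ha]; push_cast; ring
      have hm : Λ X Y + (X : ℝ) * (2 * π / (ℓ : ℝ) ^ 2) - Λ X ((Y + 1) % N) - 2 * (π * (p : ℕ) / ((ℓ : ℝ) - 1))
          = -(2 * π * (p : ℝ) / ((ℓ : ℝ) ^ 2 * ((ℓ : ℝ) - 1))) + ((0 : ℤ) : ℝ) * (2 * π) := by
        rw [hΛX, hΛX', ← hkey]; push_cast; ring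
      exact (norm_cross_dir1_le E hE H hH _ _ _ _ _ hm).trans hfin
    · have hYN : Y + 1 = N := by omega
      have hY' : (Y + 1) % N = 0 := by rw [hYN, Nat.mod_self]
      have hΛX' : Λ X ((Y + 1) % N) = -(π * p / ((ℓ : ℝ) - 1)) := by
        rw [hY', hΛ, Nat.zero_mod, ← hp]; simp
      -- `Y + 1 = N = kℓ²` ⇒ `(Y + 1)∕ℓ = kℓ`
      have hNr : ((Y : ℝ) + 1) / ℓ = k * ℓ := by
        have : ((Y + 1 : ℕ) : ℝ) = N := by exact_mod_cast hYN
        rw [← hN] at this; push_cast at this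
        rw [this]; field_simp
      have hm : Λ X Y + (X : ℝ) * (2 * π / (ℓ : ℝ) ^ 2) - Λ X ((Y + 1) % N) - 2 * (π * (p : ℕ) / ((ℓ : ℝ) - 1))
          = -(2 * π * (p : ℝ) / ((ℓ : ℝ) ^ 2 * ((ℓ : ℝ) - 1))) + (((a : ℤ) * k * ℓ : ℤ) : ℝ) * (2 * π) := by
        rw [hΛX, hΛX', ← hkey]; push_cast
        linear_combination (2 * π * (a : ℝ)) * hNr
      exact (norm_cross_dir1_le E hE H hH _ _ _ _ _ hm).trans hfin

end Steps

end Summit.QuantumFields.YangMills.Theorems.FluctuationComparisonRegPrIntLS2BetaSmallBondGaugeFluxDatumVortexSteps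

end
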